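import Summits.HodgeConjecture.HodgeConjecture.Theorems.Ring2AbelianAllAndreWeilPlaneMoves
import Literature.AlgebraicGeometry.HodgeTheory.GysinCleanBaseChange
import HarnessLib

/-!
# Ring 2 · sub-cell AbelianAll (ALL ABELIAN VARIETIES), André axis, part XLIV-b — THE FIBRE TRACE IS THE RESTRICTED CYCLE:
# `j_t^* ∘ [γ]_* ∘ j_{t*} = K · [γ|_{X_t × X_t}]_*` (`K ≠ 0`), so β at `t` is the LIFT of the identity correspondence of the invariants
# from the fibre `X_t × X_t` of the square family `𝒳 × 𝒳 → S × S` to an algebraic class of the total space `𝒳 × 𝒳`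

HONEST FRAMING (page 1, verbatim): **research route, not a corollary; conditional on HC_CM plus one named
minimal statement.** Cell line: research route conditional on HC_CM; not a corollary; Q11.4-sentence-2
already refuted in dim ≥ 3. Nothing in this file proves a case of the Hodge conjecture or of `B`; `HC_CM`
(`Theses.RankFourFaces.CMAbelianHodge`) does NOT occur; item `Theses.RankFourFaces.CMToAbelian` (stmt-16267) stays OPEN; N104 untouched;
no node is born (0 `def`). Seat `pub-hodge-ring2-ab-andre-2`, gen 36. Owed item (o134) of the seat's HANDOFF.

## Content (sorry-free, standard axioms; no named fact)

Parts XL–XLIII reduced `B⋆` of the total space `𝒳` of a compact abelian pencil `f : 𝒳 ⟶ S` (given `θ_N` and a group law) to β at ONE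
point, and β to a property of the FIBRE TRACE `v_M = j_t^* ∘ M ∘ j_{t*}` on `Hᵏ(X_t)` of ONE algebraic self-correspondence
`M = [γ]_* : H^{k+2}(𝒳) → Hᵏ(𝒳)` (`γ` a codimension-`d` class on the `(2d+2)`-fold `𝒳 × 𝒳`): `v_M = 𝟙` on the invariants
`I_t = j_t^* Hᵏ(𝒳)` (β), or merely non-degenerate there (XLI-a), or moving one Weil class off `ℂθ^{q+1}` (XLII-b). The fibre trace was
handled ABSTRACTLY (a composite of three algebraic correspondences). THIS FILE identifies it with a CYCLE CLASS ON THE FIBRE: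

* §1 `isClosedImmersion_left_of_retraction` — a split monomorphism of `ℂ`-schemes into a separated scheme is a closed immersion
  (tool for the two incidence squares below).
* §2 **`exists_fibreTrace_eq_smul_corrAction_restrict`** — for every orientation family `μ` there is ONE scalar `K ≠ 0` (depending
  on the pencil, `t` and `μ` only) with, for every class `γ ∈ H^{2e}((𝒳 × 𝒳)(ℂ))`, every degree `k` and every `x ∈ Hᵏ(X_t)`,

    `j_t^* ( [γ]_* ( j_{t*} x ) ) = K · [ (j_t × j_t)^* γ ]_* (x)`,

  i.e. **the fibre trace of `[γ]_*` is the action on `H^•(X_t)` of the RESTRICTION `γ|_{X_t × X_t} = (j_t × j_t)^* γ`** of `γ` to the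
  fibre `X_t × X_t` over `(t, t)` of the two-parameter family `𝒳 × 𝒳 → S × S`. Proof: two clean base changes
  (`complexGysin_cleanBaseChange`, Fulton Thm. 6.2 (a) / Prop. 1.7 on the tree's carriers) for the transversal squares
  `X_t × 𝒳 → 𝒳 × 𝒳` over `j_t : X_t → 𝒳` (first projection) and `X_t × X_t → X_t × 𝒳` over `j_t` (second projection), the projection
  formula for `X_t × j_t`, functoriality of Gysin maps and `j_t × j_t = (X_t ◁ j_t) ≫ (j_t ▷ 𝒳)`; `K ≠ 0` by testing the two base
  changes on `1 ∈ H⁰(X_t)` (`[X_t] ≠ 0`, part XIII-b) and on a fibre integral (`pr_{1*} pr_2^* ω ≠ 0`).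
* §3 **`betaInverse_iff_exists_restrict_acts_as_id`** (and `…_acts_as_smul`) — **β at `t` in degree `k ≤ 2d` ⟺ there is an ALGEBRAIC class `γ ∈ N^d` of
  `𝒳 × 𝒳` whose restriction to `X_t × X_t` acts as the identity on the invariants `j_t^* Hᵏ(𝒳)`.** Since the fibre trace of ANY
  β-witness is the invariant projector `P_t` (part XL-a `betaInverse_fibreTrace_eq`), this says: **β is the LIFT PROBLEM (L) for the square
  family `𝒳 × 𝒳 → S × S` at the class `P_t` on the fibre over `(t, t)`** — find an algebraic class on the total space `𝒳 × 𝒳` restricting,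
  as a correspondence on the invariants of `X_t`, to `P_t`. In the Weil habitats `P_t` IS an algebraic class of `X_t × X_t` (part XLI-b), so
  nothing is asked on the fibre; parts XXXVII–XXXIX / XLII-c show that lifts to the DIAGONAL sub-family `𝒳 ×_S 𝒳 → Δ_S` exist (relative
  Scholl classes) and are useless (zero fibre trace in degree `−2`): the content of β is the extension of `P_t` OFF the diagonal of `S × S`.
  **`map_tensorHom_fiberι_mem_span_invariants`** ((o134)): the restricted class lies in the span of the products `pr₁^* j_t^* a ∪ pr₂^* j_t^* b`
  of INVARIANT classes (Künneth + naturality) — only the `I_t ⊗ I_t`-component of `H^•(X_t × X_t)` is reached by restriction.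
* §4 `exists_fibreTrace_not_mem_iff_exists_restrict_not_mem` — hypothesis-free transfer of tests: «some algebraic `M` has fibre trace carrying
  `r x_b + s x_c` outside `V`» ⟺ «some algebraic class of `𝒳 × 𝒳` RESTRICTS to a correspondence carrying `r x_b + s x_c` outside `V`»; the
  Weil / W₆ rows of part XLII-b in restricted-cycle form are in the companion part XLIV-c (`Ring2AbelianAllAndreRestrictedCycleWeilRows`).

## Honest status

EQUIVALENT to β (both directions proved); the gain is geometric legibility — the witness is now a cycle on `𝒳 × 𝒳` tested through its
RESTRICTION to one fibre of the square family, and β is literally a lift problem of the same shape as the node (L), one level up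
(base `S × S`, class `P_t`, known algebraic on the diagonal). PRINT: the identity `Z|_{X_t × X_t}` acts as `j^* [Z]_* j_*` is Fulton's
refined restriction (Thm. 6.2, Cor. 19.2) — folklore; its use as a normal form for `B` of abelian-fibred total spaces was not located
([Tankeev2003, §§10–12] works with `ξ_k` on `𝒳 ×_C 𝒳` and the generic fibre). Nothing minimal is claimed; N104 untouched.
EDGE LABELS: all K (no binder). References: Fulton1998 (Prop. 1.7, Thm. 6.2 (a), §16.1, Cor. 19.2); FultonYoungTableaux1997 (App. B (5)–(7));
Kleiman1968AlgebraicCycles (§1.3, 2A11); VoisinHodgeII2003 (proof of Thm. 10.17 (10.7)); HatcherAT2002 (Thm. 3.15); Tankeev2003 (Thm. 10.1, 12.3);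
Andre1996Motifs (§5.1, §6.3).
-/

noncomputable section

set_option linter.dupNamespace false

namespace Summit.HodgeConjecture.HodgeConjecture.Ring2.AbelianAll

open CategoryTheory CategoryTheory.Limits AlgebraicGeometry MonoidalCategory CartesianMonoidalCategory
open Literature.AlgebraicGeometry Literature.AlgebraicGeometry.Motives
open Literature.AlgebraicGeometry.HodgeTheory
open Literature.AlgebraicTopology.SingularHomology (singularCohomology cupProduct cupProduct_gradedComm_holds cupProduct_map)
open Summit.HodgeConjecture.HodgeConjecture.Theorems (deg_fiberGysin_aux exists_fibreClassInverse_deg_of_lefschetzB)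

/-! ## §1 Split monomorphisms into separated schemes are closed immersions -/

section Retraction

/-- **A split monomorphism of `ℂ`-schemes into a scheme separated over `ℂ` is a closed immersion**: if `g ≫ r = 𝟙 A` then
`g.left ≫ r.left = 𝟙` is a closed immersion and `r.left` is separated (`r.left ≫ A.hom = B.hom` is), so `g.left` is a closed immersion
(Mathlib's cancellation `IsClosedImmersion.of_comp`). [cite: Hartshorne1977, Ch. II Cor. 4.6 and Ex. 4.8] -/
theorem isClosedImmersion_left_of_retraction {A B : SchemeOver ℂ} (g : A ⟶ B) (r : B ⟶ A) (h : g ≫ r = 𝟙 A)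
    [IsSeparated B.hom] : IsClosedImmersion g.left := by
  haveI : IsSeparated (r.left ≫ A.hom) := by
    rw [Over.w r]
    infer_instance
  haveI : IsSeparated r.left := IsSeparated.of_comp r.left A.hom
  haveI : IsClosedImmersion (g.left ≫ r.left) := by
    rw [← Over.comp_left, h, Over.id_left]
    infer_instance
  exact IsClosedImmersion.of_comp g.left r.left

end Retraction

/-! ## §2 The fibre trace of `[γ]_*` is the action of the restricted class `(j_t × j_t)^* γ` -/

section Restriction

variable {𝒳 S : SchemeOver ℂ} {d : ℕ} {f : 𝒳 ⟶ S} (hf : IsCompactAbelianPencil f d)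

/-- **THE FIBRE TRACE IS THE RESTRICTED CYCLE.** Let `f : 𝒳 ⟶ S` be a compact pencil of abelian `d`-folds, `t ∈ S(ℂ)`, `j_t : X_t ⟶ 𝒳`
the fibre, and `μ` any orientation family. There is ONE scalar `K ≠ 0` such that for every class `γ ∈ H^{2e}((𝒳 × 𝒳)(ℂ); ℂ)` acting as a
correspondence `[γ]_* : H^{k+2}(𝒳) → Hᵏ(𝒳)` (`e = d`) and every `x ∈ Hᵏ(X_t(ℂ); ℂ)`:

  `j_t^* ([γ]_* (j_{t*} x)) = K • [(j_t × j_t)^* γ]_* x`.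

Two clean base changes (Fulton, Thm. 6.2 (a) with Prop. 1.7; the tree's `complexGysin_cleanBaseChange`) — `j_t^* ∘ pr_{1*} = K₁ · pr_{1*} ∘ (j_t × 𝟙)^*`
for the square `X_t × 𝒳 → 𝒳 × 𝒳` and `pr_2^* ∘ j_{t*} = K₂ · (𝟙 × j_t)_* ∘ pr_2^*` for the square `X_t × X_t → X_t × 𝒳` — the projection
formula for `𝟙 × j_t`, functoriality, and `j_t × j_t = (X_t ◁ j_t) ≫ (j_t ▷ 𝒳)`; `K₁ ≠ 0` by a fibre integral, `K₂ ≠ 0` by `[X_t] ≠ 0`.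
[cite: Fulton1998, Prop. 1.7, Thm. 6.2 (a) and §16.1] [cite: FultonYoungTableaux1997, Appendix B §B.1 (5)–(7)] -/
theorem exists_fibreTrace_eq_smul_corrAction_restrict (μ : OrientationFamily) (t : ComplexPoints S) :
    ∃ K : ℂ, K ≠ 0 ∧ ∀ ⦃k e : ℕ⦄ (hab : k + 2 + 2 * e = k + 2 * (d + 1)) (γ : complexBetti (𝒳 ⊗ 𝒳) (2 * e))
        (x : complexBetti (fiberOver f t) k),
      complexBetti.map (fiberι f t) k
          (corrAction μ hf.isSmoothProjective_total hf.isSmoothProjective_total hab γ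
            (complexGysin μ (hf.isSmoothProjective_fiberOver t) hf.isSmoothProjective_total (fiberι f t)
              (deg_fiberGysin_aux k d) x)) =
        K • corrAction μ (hf.isSmoothProjective_fiberOver t) (hf.isSmoothProjective_fiberOver t)
            (show k + 2 * e = k + 2 * d by omega) (complexBetti.map (fiberι f t ⊗ₘ fiberι f t) (2 * e) γ) x := by
  have hμ : μ.HasPoincareDuality := OrientationFamily.hasPoincareDuality μ
  have hX := hf.isSmoothProjective_total
  have hXt := hf.isSmoothProjective_fiberOver t
  have hXX := IsSmoothProjective.tensor_holds hX hX
  have hXtX := IsSmoothProjective.tensor_holds hXt hX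
  have hXtXt := IsSmoothProjective.tensor_holds hXt hXt
  -- notation
  set j : fiberOver f t ⟶ 𝒳 := fiberι f t with hj
  haveI : IsSeparated S.hom := hf.isSmoothProjective_base.isProjectiveOver.isProper.toIsSeparated
  haveI : IsClosedImmersion j.left := Motives.isClosedImmersion_fiberι_left f t
  haveI : IsSeparated ((𝒳 ⊗ 𝒳) ⊗ fiberOver f t).hom :=
    (IsSmoothProjective.isProper_holds (IsSmoothProjective.tensor_holds hXX hXt)).toIsSeparated
  haveI : IsSeparated (fiberOver f t ⊗ (fiberOver f t ⊗ 𝒳)).hom :=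
    (IsSmoothProjective.isProper_holds (IsSmoothProjective.tensor_holds hXt hXtX)).toIsSeparated
  -- square A: `X_t × 𝒳 → 𝒳 × 𝒳` over `j : X_t → 𝒳` (first projections)
  haveI hA : IsClosedImmersion (lift (j ▷ 𝒳) (fst (fiberOver f t) 𝒳)).left := by
    refine isClosedImmersion_left_of_retraction _ (lift (snd (𝒳 ⊗ 𝒳) (fiberOver f t)) (fst _ _ ≫ snd 𝒳 𝒳)) ?_
    ext
    · simp only [Category.assoc, lift_fst, lift_snd, Category.id_comp]
    · simp only [Category.assoc, lift_snd, lift_fst_assoc, whiskerRight_snd, Category.id_comp]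
  have hincA : ∀ (P : ComplexPoints (𝒳 ⊗ 𝒳)) (Q : ComplexPoints (fiberOver f t)),
      AlgPoints.map (fst 𝒳 𝒳) P = AlgPoints.map j Q →
      ∃ R : ComplexPoints (fiberOver f t ⊗ 𝒳), AlgPoints.map (j ▷ 𝒳) R = P ∧ AlgPoints.map (fst (fiberOver f t) 𝒳) R = Q := by
    intro P Q h
    set R : ComplexPoints (fiberOver f t ⊗ 𝒳) := AlgPoints.prodEquiv.symm (Q, AlgPoints.map (snd 𝒳 𝒳) P) with hR
    have hR1 : AlgPoints.map (fst (fiberOver f t) 𝒳) R = Q := by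
      rw [← AlgPoints.prodEquiv_apply_fst, hR, Equiv.apply_symm_apply]
    have hR2 : AlgPoints.map (snd (fiberOver f t) 𝒳) R = AlgPoints.map (snd 𝒳 𝒳) P := by
      rw [← AlgPoints.prodEquiv_apply_snd, hR, Equiv.apply_symm_apply]
    refine ⟨R, AlgPoints.prodEquiv.injective (Prod.ext ?_ ?_), hR1⟩
    · rw [AlgPoints.prodEquiv_apply_fst, AlgPoints.prodEquiv_apply_fst, ← AlgPoints.map_comp_apply, whiskerRight_fst,
        AlgPoints.map_comp_apply, hR1, h]
    · rw [AlgPoints.prodEquiv_apply_snd, AlgPoints.prodEquiv_apply_snd, ← AlgPoints.map_comp_apply, whiskerRight_snd, hR2]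
  obtain ⟨K₁, hK₁⟩ := complexGysin_cleanBaseChange μ hXX hX hXt hXtX (fst 𝒳 𝒳) j (j ▷ 𝒳) (fst (fiberOver f t) 𝒳)
    (by omega) hincA
  -- square B: `X_t × X_t → X_t × 𝒳` over `j : X_t → 𝒳` (second projections)
  haveI hB : IsClosedImmersion (lift (snd (fiberOver f t) (fiberOver f t)) (fiberOver f t ◁ j)).left := by
    refine isClosedImmersion_left_of_retraction _ (lift (snd _ _ ≫ fst (fiberOver f t) 𝒳) (fst _ _)) ?_
    ext
    · simp only [Category.assoc, lift_fst, lift_snd_assoc, whiskerLeft_fst, Category.id_comp]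
    · simp only [Category.assoc, lift_snd, lift_fst, Category.id_comp]
  have hincB : ∀ (P : ComplexPoints (fiberOver f t)) (Q : ComplexPoints (fiberOver f t ⊗ 𝒳)),
      AlgPoints.map j P = AlgPoints.map (snd (fiberOver f t) 𝒳) Q →
      ∃ R : ComplexPoints (fiberOver f t ⊗ fiberOver f t),
        AlgPoints.map (snd (fiberOver f t) (fiberOver f t)) R = P ∧ AlgPoints.map (fiberOver f t ◁ j) R = Q := by
    intro P Q h
    set R : ComplexPoints (fiberOver f t ⊗ fiberOver f t) :=
      AlgPoints.prodEquiv.symm (AlgPoints.map (fst (fiberOver f t) 𝒳) Q, P) with hR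
    have hR1 : AlgPoints.map (fst (fiberOver f t) (fiberOver f t)) R = AlgPoints.map (fst (fiberOver f t) 𝒳) Q := by
      rw [← AlgPoints.prodEquiv_apply_fst, hR, Equiv.apply_symm_apply]
    have hR2 : AlgPoints.map (snd (fiberOver f t) (fiberOver f t)) R = P := by
      rw [← AlgPoints.prodEquiv_apply_snd, hR, Equiv.apply_symm_apply]
    refine ⟨R, hR2, AlgPoints.prodEquiv.injective (Prod.ext ?_ ?_)⟩
    · rw [AlgPoints.prodEquiv_apply_fst, AlgPoints.prodEquiv_apply_fst, ← AlgPoints.map_comp_apply, whiskerLeft_fst, hR1]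
    · rw [AlgPoints.prodEquiv_apply_snd, AlgPoints.prodEquiv_apply_snd, ← AlgPoints.map_comp_apply, whiskerLeft_snd,
        AlgPoints.map_comp_apply, hR2, h]
  obtain ⟨K₂, hK₂⟩ := complexGysin_cleanBaseChange μ hXt hX hXtX hXtXt j (snd (fiberOver f t) 𝒳)
    (snd (fiberOver f t) (fiberOver f t)) (fiberOver f t ◁ j) (by omega) hincB
  refine ⟨K₁ * K₂, mul_ne_zero ?_ ?_, fun k e hab γ x ↦ ?_⟩
  · -- `K₁ ≠ 0`: test on a fibre integral `pr_{1*} pr_2^* w ≠ 0` in `H⁰(𝒳)`, whose pull-back to `X_t` is non-zero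
    obtain ⟨w, hw⟩ := exists_complexGysin_fst_map_snd_ne_zero μ hX hX
    obtain ⟨c, hc⟩ := exists_eq_smul_one μ hX
      (complexGysin μ hXX hX (fst 𝒳 𝒳) (show 2 * (d + 1) + 2 * (d + 1) = 0 + 2 * (d + 1 + (d + 1)) by omega)
        (complexBetti.map (snd 𝒳 𝒳) (2 * (d + 1)) w))
    have hc0 : c ≠ 0 := by
      rintro rfl
      exact hw (by rw [hc, zero_smul])
    have h1 : singularCohomology.one ℂ (ComplexPoints (fiberOver f t)) ≠ 0 := by
      intro h0
      apply fiberGysin_one_ne_zero hf t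
      rw [h0, map_zero]
    intro hK
    have h := hK₁ (show 2 * (d + 1) + 2 * (d + 1) = 0 + 2 * (d + 1 + (d + 1)) by omega)
      (complexBetti.map (snd 𝒳 𝒳) (2 * (d + 1)) w)
    rw [hK, zero_smul, hc, map_smul] at h
    change c • singularCohomology.map ℂ ℂ (AlgPoints.mapContinuous (L := ℂ) j) 0 (singularCohomology.one ℂ _) = 0 at h
    rw [singularCohomology.map_one] at h
    exact (smul_ne_zero hc0 h1) h
  · -- `K₂ ≠ 0`: test on `1 ∈ H⁰(X_t)`: `pr_2^* [X_t] ≠ 0` (the fibre class is non-zero and `pr_2` has a section)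
    haveI := connectedSpace_complexPoints hXt
    obtain ⟨P⟩ : Nonempty (ComplexPoints (fiberOver f t)) := inferInstance
    have hcls : complexGysin μ hXt hX j (show 0 + 2 * (d + 1) = 2 * 1 + 2 * d by omega)
        (singularCohomology.one ℂ (ComplexPoints (fiberOver f t))) ≠ 0 :=
      complexGysin_one_ne_zero_of_stalkMap_surjective μ hX hXt j P (j.left.stalkMap_surjective P.pt) (e := 1) (by omega)
    -- a section of `pr_2 : X_t × 𝒳 → 𝒳`
    set σ : 𝒳 ⟶ fiberOver f t ⊗ 𝒳 := lift (toSpecOver 𝒳 ≫ P) (𝟙 𝒳) with hσ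
    have hσs : σ ≫ snd (fiberOver f t) 𝒳 = 𝟙 𝒳 := lift_snd _ _
    have hinj : ∀ {i : ℕ} (z : complexBetti 𝒳 i), complexBetti.map (snd (fiberOver f t) 𝒳) i z = 0 → z = 0 := by
      intro i z hz
      have h2 : complexBetti.map σ i (complexBetti.map (snd (fiberOver f t) 𝒳) i z) = z := by
        rw [← CategoryTheory.comp_apply, ← complexBetti.map_comp, hσs, complexBetti.map_id, CategoryTheory.id_apply]
      rw [← h2, hz, map_zero]
    intro hK
    have h := hK₂ (show 0 + 2 * (d + 1) = 2 * 1 + 2 * d by omega) (singularCohomology.one ℂ (ComplexPoints (fiberOver f t)))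
    rw [hK, zero_smul] at h
    exact hcls (hinj _ h)
  · -- the identity
    rw [corrAction_apply, corrAction_apply, hK₁ (corrAction_degree (d + 1) hab), cupProduct_map]
    -- `(j ▷ 𝒳)^* pr_2^* = pr_2^*` on `X_t × 𝒳`
    have e1 : complexBetti.map (j ▷ 𝒳) (k + 2)
        (complexBetti.map (snd 𝒳 𝒳) (k + 2) (complexGysin μ hXt hX j (deg_fiberGysin_aux k d) x)) =
        complexBetti.map (snd (fiberOver f t) 𝒳) (k + 2) (complexGysin μ hXt hX j (deg_fiberGysin_aux k d) x) := by
      rw [← CategoryTheory.comp_apply, ← complexBetti.map_comp, whiskerRight_snd]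
    rw [e1, hK₂ (deg_fiberGysin_aux k d) x, LinearMap.map_smul₂, map_smul, smul_smul]
    congr 1
    -- the projection formula for `p = X_t ◁ j : X_t × X_t → X_t × 𝒳`
    set p : fiberOver f t ⊗ fiberOver f t ⟶ fiberOver f t ⊗ 𝒳 := fiberOver f t ◁ j with hp
    set u : complexBetti (fiberOver f t ⊗ fiberOver f t) k := complexBetti.map (snd (fiberOver f t) (fiberOver f t)) k x with hu
    set γ' : complexBetti (fiberOver f t ⊗ 𝒳) (2 * e) := complexBetti.map (j ▷ 𝒳) (2 * e) γ with hγ'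
    have hsign₁ : ((-1 : ℂ) ^ ((k + 2) * (2 * e))) = 1 := Even.neg_one_pow ⟨(k + 2) * e, by ring⟩
    have hsign₂ : ((-1 : ℂ) ^ (2 * e * k)) = 1 := Even.neg_one_pow ⟨e * k, by ring⟩
    have e2 : cupProduct (rfl : k + 2 + 2 * e = k + 2 + 2 * e)
        (complexGysin μ hXtXt hXtX p (show k + 2 * (d + (d + 1)) = k + 2 + 2 * (d + d) by omega) u) γ' =
        complexGysin μ hXtXt hXtX p (show k + 2 * e + 2 * (d + (d + 1)) = k + 2 + 2 * e + 2 * (d + d) by omega)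
          (cupProduct (rfl : k + 2 * e = k + 2 * e) u (complexBetti.map p (2 * e) γ')) := by
      rw [cupProduct_gradedComm_holds ℂ _ (rfl : k + 2 + 2 * e = k + 2 + 2 * e) (show 2 * e + (k + 2) = k + 2 + 2 * e by omega),
        hsign₁, one_smul,
        ← complexGysin_cup hμ hXtXt hXtX p (show 2 * e + k = k + 2 * e by omega)
          (show k + 2 * e + 2 * (d + (d + 1)) = k + 2 + 2 * e + 2 * (d + d) by omega)
          (show k + 2 * (d + (d + 1)) = k + 2 + 2 * (d + d) by omega) (show 2 * e + (k + 2) = k + 2 + 2 * e by omega),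
        cupProduct_gradedComm_holds ℂ _ (show 2 * e + k = k + 2 * e by omega) (rfl : k + 2 * e = k + 2 * e), hsign₂, one_smul]
    rw [e2, ← LinearMap.comp_apply (f := complexGysin μ hXtX hXt (fst (fiberOver f t) 𝒳) _),
      ← complexGysin_comp hμ hXtXt hXtX hXt p (fst (fiberOver f t) 𝒳)
        (show k + 2 * e + 2 * (d + (d + 1)) = k + 2 + 2 * e + 2 * (d + d) by omega) (corrAction_degree d hab)]
    -- `p ≫ pr_1 = pr_1` and `p^* (j ▷ 𝒳)^* = (j × j)^*`
    have e3 : p ≫ fst (fiberOver f t) 𝒳 = fst (fiberOver f t) (fiberOver f t) := whiskerLeft_fst _ _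
    have e4 : complexBetti.map p (2 * e) γ' = complexBetti.map (j ⊗ₘ j) (2 * e) γ := by
      rw [hγ', ← CategoryTheory.comp_apply, ← complexBetti.map_comp, hp, ← tensorHom_def']
    simp only [e3]
    rw [e4]

end Restriction

/-! ## §3 β is the lift of the identity correspondence of the invariants from `X_t × X_t` to `𝒳 × 𝒳`; Künneth bookkeeping -/

section Lift

variable {𝒳 S : SchemeOver ℂ} {d : ℕ} {f : 𝒳 ⟶ S} (hf : IsCompactAbelianPencil f d)

/-- `𝐆[hf, s, k]` — `j_{s*} : Hᵏ(X_s(ℂ); ℂ) → H^{k+2}(𝒳(ℂ); ℂ)` for the complex orientations (display notation, as in part XL-a).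
[cite: FultonYoungTableaux1997, Appendix B §B.1 (5)] -/
local notation3 (prettyPrint := false) "𝐆[" hf ", " s ", " k "]" =>
  complexGysin complexOrientationFamily (IsCompactAbelianPencil.isSmoothProjective_fiberOver hf s)
    (IsCompactAbelianPencil.isSmoothProjective_total hf) (fiberι f s) (deg_fiberGysin_aux k d)

/-- `𝐣[s, k]` — `j_s^* : Hᵏ(𝒳(ℂ); ℂ) → Hᵏ(X_s(ℂ); ℂ)` as a linear map (display notation). [cite: VoisinHodgeI2002, §7.3.2] -/
local notation3 (prettyPrint := false) "𝐣[" s ", " k "]" => (complexBetti.map (fiberι f s) k).hom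

/-- `𝐑[hf, t, k]` — the action on `Hᵏ(X_t(ℂ); ℂ)` of a codimension-`d` class of `X_t × X_t` (an endomorphism-correspondence of the
`d`-fold `X_t`), for the complex orientations (display notation). [cite: VoisinHodgeII2003, proof of Thm. 10.17 (10.7)] -/
local notation3 (prettyPrint := false) "𝐑[" hf ", " t ", " k "]" =>
  corrAction complexOrientationFamily (IsCompactAbelianPencil.isSmoothProjective_fiberOver hf t)
    (IsCompactAbelianPencil.isSmoothProjective_fiberOver hf t) (rfl : k + 2 * d = k + 2 * d)

/-- **β ⟺ THE IDENTITY OF THE INVARIANTS LIFTS FROM `X_t × X_t` TO AN ALGEBRAIC CLASS OF `𝒳 × 𝒳`.** For a compact pencil of abelian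
`d`-folds, `t ∈ S(ℂ)` and `k ≤ 2d`: there is an ALGEBRAIC `T : H^{k+2}(𝒳) → Hᵏ(𝒳)` with `j_t^* T j_{t*} j_t^* = j_t^*` (β at `t` in degree `k`)
IF AND ONLY IF there is an algebraic class `γ ∈ N^d H^{2d}((𝒳 × 𝒳)(ℂ))` whose RESTRICTION `(j_t × j_t)^* γ` to the fibre `X_t × X_t` of the
square family acts as the identity on the invariants `j_t^* Hᵏ(𝒳)`: `[(j_t × j_t)^* γ]_* (j_t^* W) = j_t^* W`. (⟹: normalise `T = [γ₀]_*` to the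
complex orientations, part XXII-e, and take `γ = K γ₀` with §2's `K`; ⟸: `T = K⁻¹ [γ]_*`.) β is the lift problem (L) for `𝒳 × 𝒳 → S × S` at the
invariant projector `P_t` of part XL-a (any class acting on `j_t^* Hᵏ(𝒳)` as the identity will do). [cite: Fulton1998, Thm. 6.2 (a) and §16.1]
[cite: Kleiman1968AlgebraicCycles, Appendix to §2, Thm. 2A11] [cite: Andre1996Motifs, §5.1 (p. 25) and §6.3] -/
theorem betaInverse_iff_exists_restrict_acts_as_id (t : ComplexPoints S) {k : ℕ} (hk : k ≤ 2 * d) :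
    (∃ T : complexBetti 𝒳 (k + 2) →ₗ[ℂ] complexBetti 𝒳 k, IsAlgebraicCorrespondence (d + 1) (d + 1) 𝒳 𝒳 T ∧
        ∀ W, 𝐣[t, k] (T (𝐆[hf, t, k] (𝐣[t, k] W))) = 𝐣[t, k] W) ↔
      ∃ γ ∈ algebraicClasses (𝒳 ⊗ 𝒳) d, ∀ W : complexBetti 𝒳 k,
        𝐑[hf, t, k] (complexBetti.map (fiberι f t ⊗ₘ fiberι f t) (2 * d) γ) (𝐣[t, k] W) = 𝐣[t, k] W := by
  have hX := hf.isSmoothProjective_total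
  obtain ⟨K, hK0, hK⟩ := exists_fibreTrace_eq_smul_corrAction_restrict hf complexOrientationFamily t
  constructor
  · rintro ⟨T, algT, hT⟩
    obtain ⟨e, hab, γ, hγ, rfl⟩ := IsAlgebraicCorrespondence.exists_eq_corrAction hX hX algT
    obtain rfl : e = d := by omega
    refine ⟨K • γ, Submodule.smul_mem _ _ hγ, fun W ↦ ?_⟩
    have h := hK hab γ (𝐣[t, k] W)
    rw [hT W] at h
    rw [map_smul, map_smul, LinearMap.smul_apply]
    exact h.symm
  · rintro ⟨γ, hγ, hid⟩
    have hab : k + 2 + 2 * d = k + 2 * (d + 1) := by omega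
    refine ⟨K⁻¹ • corrAction complexOrientationFamily hX hX hab γ,
      IsAlgebraicCorrespondence.smul hX hX (isAlgebraicCorrespondence_corrAction_complex hX hX hab (by omega) hγ) K⁻¹,
      fun W ↦ ?_⟩
    rw [LinearMap.smul_apply, map_smul, hK hab γ (𝐣[t, k] W), smul_smul, inv_mul_cancel₀ hK0, one_smul, hid W]

/-- **The same with the scalar left free**: β at `t` in degree `k ≤ 2d` iff some algebraic class of `𝒳 × 𝒳` restricts on `X_t × X_t` to a
correspondence acting on the invariants `j_t^* Hᵏ(𝒳)` as a NON-ZERO homothety (rescale the class). [cite: Fulton1998, Thm. 6.2 (a) and §16.1]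
[cite: Kleiman1968AlgebraicCycles, Appendix to §2, Thm. 2A11] -/
theorem betaInverse_iff_exists_restrict_acts_as_smul (t : ComplexPoints S) {k : ℕ} (hk : k ≤ 2 * d) :
    (∃ T : complexBetti 𝒳 (k + 2) →ₗ[ℂ] complexBetti 𝒳 k, IsAlgebraicCorrespondence (d + 1) (d + 1) 𝒳 𝒳 T ∧
        ∀ W, 𝐣[t, k] (T (𝐆[hf, t, k] (𝐣[t, k] W))) = 𝐣[t, k] W) ↔
      ∃ γ ∈ algebraicClasses (𝒳 ⊗ 𝒳) d, ∃ c : ℂ, c ≠ 0 ∧ ∀ W : complexBetti 𝒳 k,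
        𝐑[hf, t, k] (complexBetti.map (fiberι f t ⊗ₘ fiberι f t) (2 * d) γ) (𝐣[t, k] W) = c • 𝐣[t, k] W := by
  rw [betaInverse_iff_exists_restrict_acts_as_id hf t hk]
  constructor
  · rintro ⟨γ, hγ, hid⟩
    exact ⟨γ, hγ, 1, one_ne_zero, fun W ↦ by rw [one_smul, hid W]⟩
  · rintro ⟨γ, hγ, c, hc, hcW⟩
    refine ⟨c⁻¹ • γ, Submodule.smul_mem _ _ hγ, fun W ↦ ?_⟩
    rw [map_smul, map_smul, LinearMap.smul_apply, hcW W, smul_smul, inv_mul_cancel₀ hc, one_smul]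

include hf in
/-- **ONLY THE `I_t ⊗ I_t`-COMPONENT IS REACHED BY RESTRICTION (Künneth bookkeeping, (o134)).** For every class `γ ∈ Hⁿ((𝒳 × 𝒳)(ℂ); ℂ)`,
the restriction `(j_t × j_t)^* γ ∈ Hⁿ((X_t × X_t)(ℂ); ℂ)` lies in the span of the cross products `pr_1^* (j_t^* a) ∪ pr_2^* (j_t^* b)` of
INVARIANT classes `j_t^* a ∈ j_t^* Hⁱ(𝒳)`, `j_t^* b ∈ j_t^* H^{i'}(𝒳)` (`i + i' = n`): cross products span `H^•(𝒳 × 𝒳)` (Künneth over a field,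
the tree's `kunnethSpan_complexBetti`) and `(j_t × j_t)^* (pr_1^* a ∪ pr_2^* b) = pr_1^* j_t^* a ∪ pr_2^* j_t^* b`. With §2: the fibre trace of
ANY self-correspondence of `𝒳` is a correspondence of `X_t` supported on `I_t ⊗ I_t ⊆ H^•(X_t) ⊗ H^•(X_t)`, `I_t = j_t^* H^•(𝒳)` the
monodromy invariants (Deligne) — so a β-witness must realise the identity of `I_t` INSIDE the image of `N^d(𝒳 × 𝒳) → I_t ⊗ I_t`.
[cite: HatcherAT2002, §3.2 Thm. 3.15] [cite: DeligneHodgeII1971, Thm. 4.1.1] [cite: VoisinHodgeI2002, §11.3.3 Lemma 11.41] -/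
theorem map_tensorHom_fiberι_mem_span_invariants (t : ComplexPoints S) {n : ℕ} (γ : complexBetti (𝒳 ⊗ 𝒳) n) :
    complexBetti.map (fiberι f t ⊗ₘ fiberι f t) n γ ∈ Submodule.span ℂ
      {v | ∃ (i i' : ℕ) (h : i + i' = n) (a : complexBetti 𝒳 i) (b : complexBetti 𝒳 i'),
        v = cupProduct h (complexBetti.map (fst (fiberOver f t) (fiberOver f t)) i (complexBetti.map (fiberι f t) i a))
              (complexBetti.map (snd (fiberOver f t) (fiberOver f t)) i' (complexBetti.map (fiberι f t) i' b))} := by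
  have hX := hf.isSmoothProjective_total
  set j := fiberι f t with hj
  refine Submodule.span_induction ?_ ?_ (fun x y _ _ hx hy ↦ ?_) (fun a x _ hx ↦ ?_) (kunnethSpan_complexBetti hX hX n γ)
  · rintro _ ⟨i, i', h, a, b, rfl⟩
    refine Submodule.subset_span ⟨i, i', h, a, b, ?_⟩
    have e₁ : complexBetti.map (j ⊗ₘ j) i (complexBetti.map (fst 𝒳 𝒳) i a) =
        complexBetti.map (fst (fiberOver f t) (fiberOver f t)) i (complexBetti.map j i a) := by
      rw [← CategoryTheory.comp_apply, ← complexBetti.map_comp, tensorHom_fst, complexBetti.map_comp, CategoryTheory.comp_apply]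
    have e₂ : complexBetti.map (j ⊗ₘ j) i' (complexBetti.map (snd 𝒳 𝒳) i' b) =
        complexBetti.map (snd (fiberOver f t) (fiberOver f t)) i' (complexBetti.map j i' b) := by
      rw [← CategoryTheory.comp_apply, ← complexBetti.map_comp, tensorHom_snd, complexBetti.map_comp, CategoryTheory.comp_apply]
    rw [cupProduct_map, e₁, e₂]
  · rw [map_zero]
    exact Submodule.zero_mem _
  · rw [map_add]
    exact Submodule.add_mem _ hx hy
  · rw [map_smul]
    exact Submodule.smul_mem _ a hx

/-! ## §4 The Weil rows with the fibre trace replaced by the restricted cycle -/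

/-- **A TEST THROUGH THE FIBRE TRACE IS A TEST THROUGH THE RESTRICTED CYCLE** (hypothesis-free). For `k ≤ 2d`, test classes `x_b, x_c ∈ Hᵏ(X_t)`
and a subspace `V ⊆ Hᵏ(X_t)`: some ALGEBRAIC `M : H^{k+2}(𝒳) → Hᵏ(𝒳)` has `j_t^* M j_{t*} (r x_b + s x_c) ∉ V` for some `r, s` IFF some algebraic
class `γ ∈ N^d(𝒳 × 𝒳)` has `[(j_t × j_t)^* γ]_* (r x_b + s x_c) ∉ V` for some `r, s` (§2 with `K ≠ 0`; `V` is a subspace).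
[cite: Fulton1998, Thm. 6.2 (a) and §16.1] [cite: VoisinHodgeII2003, proof of Thm. 10.17 (10.7)] -/
theorem exists_fibreTrace_not_mem_iff_exists_restrict_not_mem (t : ComplexPoints S) {k : ℕ} (hk : k ≤ 2 * d)
    (xb xc : complexBetti (fiberOver f t) k) (V : Submodule ℂ (complexBetti (fiberOver f t) k)) :
    (∃ M : complexBetti 𝒳 (k + 2) →ₗ[ℂ] complexBetti 𝒳 k, IsAlgebraicCorrespondence (d + 1) (d + 1) 𝒳 𝒳 M ∧
        ∃ r s : ℂ, 𝐣[t, k] (M (𝐆[hf, t, k] (r • xb + s • xc))) ∉ V) ↔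
      ∃ γ ∈ algebraicClasses (𝒳 ⊗ 𝒳) d, ∃ r s : ℂ,
        𝐑[hf, t, k] (complexBetti.map (fiberι f t ⊗ₘ fiberι f t) (2 * d) γ) (r • xb + s • xc) ∉ V := by
  have hX := hf.isSmoothProjective_total
  obtain ⟨K, hK0, hK⟩ := exists_fibreTrace_eq_smul_corrAction_restrict hf complexOrientationFamily t
  constructor
  · rintro ⟨M, algM, r, s, hmove⟩
    obtain ⟨e, hab, γ, hγ, rfl⟩ := IsAlgebraicCorrespondence.exists_eq_corrAction hX hX algM
    obtain rfl : e = d := by omega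
    refine ⟨γ, hγ, r, s, fun hmem ↦ hmove ?_⟩
    rw [hK hab γ]
    exact Submodule.smul_mem _ _ hmem
  · rintro ⟨γ, hγ, r, s, hmove⟩
    have hab : k + 2 + 2 * d = k + 2 * (d + 1) := by omega
    refine ⟨corrAction complexOrientationFamily hX hX hab γ, isAlgebraicCorrespondence_corrAction_complex hX hX hab (by omega) hγ,
      r, s, fun hmem ↦ hmove ?_⟩
    rw [hK hab γ] at hmem
    have h := Submodule.smul_mem V K⁻¹ hmem
    rwa [smul_smul, inv_mul_cancel₀ hK0, one_smul] at h

end Lift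


end Summit.HodgeConjecture.HodgeConjecture.Ring2.AbelianAll

end
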